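import Summits.ResolutionOfSingularities.ResolutionOfSingularities.Theses.RisoStrata

/-!
# Crux `RtdLocal` (stmt-ResolutionOfSingularities-18840) — the hypothesis `B.FG` is load-bearing

Route `ResolutionOfSingularities/RisoStrata`, crux `RtdLocal` (Zariski-locality of the typed
riso-triviality dimension under `B ↦ B[s⁻¹]`).  `rtdLocal_false_without_FG` proves that the crux
with the single hypothesis `B.FG` deleted (everything else verbatim) is FALSE.

Witness: `p = 2`, `k = 𝔽₂^alg`, `K = k(X₀,X₁)`, `B = k + X₀·k[X₀,X₁] = k[X₀, X₀X₁, X₀X₁², …]`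
(the image of the support subalgebra `S' = {P : every monomial X₀ᵃX₁ᵇ of P with a = 0 has b = 0}`),
`s = X₀ ∈ B`, `r = 0`, `m' =` ANY maximal ideal of `B' := k[B ∪ {X₀⁻¹}] = k[X₀, X₀⁻¹, X₁]`.
* LHS `Rtd B' m' 0` holds: `B'` is generated by `X₀, X₀⁻¹, X₁`; by the Nullstellensatz
  (`MvPolynomial.isMaximal_iff_eq_vanishingIdeal_singleton` applied to `m'.comap Φ`,
  `Φ : k[T₀,T₁,T₂] ↠ B'`) the three generators shifted by scalars lie in `m'` and still generate;
  with the identity straightener `φ a = a(g)` and `W = 0` clauses (1)–(3) are immediate.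
* RHS `Rtd B m 0` fails: clause "`adjoin k (range g) = B`" would make `B` finitely generated, but
  `S'` is not (`rtdLocalNeg_not_fg_of_support`: generators of `X₁`-degree `≤ N` only produce
  monomials with `b ≤ N a`, missing `X₀X₁^{N+1}`), and `B ≅ S'` (`Subalgebra.fg_of_fg_map`).
Moral for provers: `B.FG` is used exactly once — to produce a finite presentation `g ⊆ m` of `B`
(r = 0 already needs it); the localisation `B[s⁻¹]` can be finitely generated when `B` is not.
No definitions (the two subalgebras are produced by an existence lemma), no facts; kernel-only.
-/

set_option linter.dupNamespace false

namespace Summit.ResolutionOfSingularities.ResolutionOfSingularities.Theorems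

open MvPolynomial

/-- Polynomials whose exponent vectors all satisfy an additively closed predicate form a
subalgebra (existence form, to keep this file definition-free). [folklore] -/
theorem rtdLocalNeg_exists_supportSubalgebra {σ : Type} {k : Type} [Field k]
    (p : (σ →₀ ℕ) → Prop) (h0 : p 0) (hadd : ∀ a b, p a → p b → p (a + b)) :
    ∃ S : Subalgebra k (MvPolynomial σ k), ∀ P, P ∈ S ↔ ∀ d ∈ P.support, p d := by
  classical
  have hC : ∀ (c : k), ∀ d ∈ (C c : MvPolynomial σ k).support, p d := by
    intro c d hd
    rw [C_apply, support_monomial] at hd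
    split_ifs at hd with hc
    · simp at hd
    · rw [Finset.mem_singleton] at hd
      rw [hd]
      exact h0
  refine ⟨{ carrier := {P | ∀ d ∈ P.support, p d}
            mul_mem' := ?_, one_mem' := ?_, add_mem' := ?_, zero_mem' := ?_,
            algebraMap_mem' := ?_ }, fun P => Iff.rfl⟩
  · intro P Q hP hQ d hd
    obtain ⟨a, ha, b, hb, rfl⟩ := Finset.mem_add.mp (support_mul P Q hd)
    exact hadd a b (hP a ha) (hQ b hb)
  · intro d hd
    rw [← C_1] at hd
    exact hC 1 d hd
  · intro P Q hP hQ d hd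
    rcases Finset.mem_union.mp (Finsupp.support_add hd) with h | h
    exacts [hP d h, hQ d h]
  · intro d hd
    simp at hd
  · intro c d hd
    rw [MvPolynomial.algebraMap_eq] at hd
    exact hC c d hd

/-- `k + X₀·k[X₀,X₁] ⊆ k[X₀,X₁]` (polynomials `P` with `P(0,X₁)` constant) is NOT a finitely
generated `k`-algebra: generators with `X₁`-degree `≤ N` only produce monomials `X₀ᵃX₁ᵇ` with
`b ≤ N a`, missing `X₀X₁^{N+1}`. [folklore] -/
theorem rtdLocalNeg_not_fg_of_support {k : Type} [Field k] (S' : Subalgebra k (MvPolynomial (Fin 2) k))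
    (hS' : ∀ P, P ∈ S' ↔ ∀ d ∈ P.support, d 0 = 0 → d 1 = 0) : ¬ S'.FG := by
  classical
  rintro ⟨T, hT⟩
  let N : ℕ := T.sup fun t => (t : MvPolynomial (Fin 2) k).degreeOf 1
  obtain ⟨SN, hSN⟩ := rtdLocalNeg_exists_supportSubalgebra (k := k) (σ := Fin 2)
    (fun d => d 1 ≤ N * d 0) (by simp) (fun a b ha hb => by
      simp only [Finsupp.coe_add, Pi.add_apply, mul_add]
      exact add_le_add ha hb)
  have hTS : (T : Set (MvPolynomial (Fin 2) k)) ⊆ SN := fun t ht => (hSN t).mpr fun d hd => by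
    by_cases hd0 : d 0 = 0
    · have ht' : t ∈ S' := by rw [← hT]; exact Algebra.subset_adjoin ht
      rw [(hS' t).mp ht' d hd hd0]
      exact Nat.zero_le _
    · calc d 1 ≤ (t : MvPolynomial (Fin 2) k).degreeOf 1 := monomial_le_degreeOf 1 hd
        _ ≤ N := Finset.le_sup (f := fun t => (t : MvPolynomial (Fin 2) k).degreeOf 1) ht
        _ ≤ N * d 0 := Nat.le_mul_of_pos_right N (Nat.pos_of_ne_zero hd0)
  have hle : S' ≤ SN := by rw [← hT]; exact Algebra.adjoin_le hTS
  have hmon : (X 0 * X 1 ^ (N + 1) : MvPolynomial (Fin 2) k) =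
      monomial (Finsupp.single 0 1 + Finsupp.single 1 (N + 1)) 1 := by
    rw [X_pow_eq_monomial, X, monomial_mul, one_mul]
  have hsupp : (X 0 * X 1 ^ (N + 1) : MvPolynomial (Fin 2) k).support =
      {Finsupp.single 0 1 + Finsupp.single 1 (N + 1)} := by
    rw [hmon, support_monomial, if_neg one_ne_zero]
  have hmem : (X 0 * X 1 ^ (N + 1) : MvPolynomial (Fin 2) k) ∈ S' := by
    refine (hS' _).mpr fun d hd h0 => ?_
    rw [hsupp, Finset.mem_singleton] at hd
    subst hd
    simp at h0
  have hnot : (X 0 * X 1 ^ (N + 1) : MvPolynomial (Fin 2) k) ∉ SN := fun h => by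
    have := (hSN _).mp h (Finsupp.single 0 1 + Finsupp.single 1 (N + 1))
      (by rw [hsupp, Finset.mem_singleton])
    simp at this
  exact hnot (hle hmem)

/-- **`B.FG` is load-bearing in `RtdLocal`**: the crux `RisoStrata.RtdLocal` with the hypothesis
`B.FG` deleted (all other text verbatim) is false.
Witness `p = 2`, `k = 𝔽₂^alg`, `K = k(X₀,X₁)`, `B = k + X₀·k[X₀,X₁]` (not f.g.), `s = X₀`,
`B' = k[B ∪ {X₀⁻¹}] = k[X₀, X₀⁻¹, X₁]`, any maximal `m'`, `r = 0`: `Rtd B' m' 0` holds (shift the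
three generators into `m'` by the Nullstellensatz, identity straightener, `W = 0`), while
`Rtd B m 0` would exhibit a finite presentation of `B`. [folklore] -/
theorem rtdLocal_false_without_FG : ¬ (∀ p : ℕ, p.Prime → ∀ (k : Type) [Field k] [CharP k p] [IsAlgClosed k] (K : Type) [Field K] [Algebra k K] (B : Subalgebra k K) (s : K) (hs : s ∈ B), s ≠ 0 → let Arc : ∀ (B : Subalgebra k K), Ideal ↥B → Type := fun B m => {α : ↥B →ₐ[k] HahnSeries ℚ k // ∀ b ∈ m, 0 < (α b).orderTop}; let Rtd : ∀ (B : Subalgebra k K), Ideal ↥B → ℕ → Prop := fun B m r => ∃ (n : ℕ) (g : Fin n → ↥B), (∀ i, g i ∈ m) ∧ Algebra.adjoin k (Set.range fun i => (g i : K)) = B ∧ ∃ W : Submodule k (Fin n → k), r ≤ Module.finrank k ↥W ∧ ∃ φ : Arc B m → (Fin n → HahnSeries ℚ k), (∀ a b : Arc B m, a ≠ b → ∃ j, ∀ i, (a.1 (g j) - b.1 (g j)).orderTop < ((φ a i - φ b i) - (a.1 (g i) - b.1 (g i))).orderTop) ∧ (∀ a i, 0 < (φ a i).orderTop) ∧ (∀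 a, ∀ w : Fin n → HahnSeries ℚ k, (∀ i, 0 < (w i).orderTop) → w ∈ Submodule.span (HahnSeries ℚ k) ((fun u : Fin n → k => fun i => HahnSeries.C (u i)) '' (W : Set (Fin n → k))) → ∃ b, φ b = φ a + w); ∀ (m' : Ideal ↥(Algebra.adjoin k ((B : Set K) ∪ {s⁻¹}))), m'.IsMaximal → ∀ r : ℕ, (Rtd (Algebra.adjoin k ((B : Set K) ∪ {s⁻¹})) m' r ↔ Rtd B (m'.comap (Subalgebra.inclusion (show B ≤ Algebra.adjoin k ((B : Set K) ∪ {s⁻¹}) from fun _ hb => Algebra.subset_adjoin (Set.mem_union_left _ hb)))) r)) := by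
  intro H
  obtain ⟨k, _i1, _i2, _i3, K, _i4, _i5, ι, hι⟩ : ∃ (k : Type) (_ : Field k) (_ : CharP k 2)
      (_ : IsAlgClosed k) (K : Type) (_ : Field K) (_ : Algebra k K)
      (ι : MvPolynomial (Fin 2) k →ₐ[k] K), Function.Injective ι :=
    ⟨AlgebraicClosure (ZMod 2), inferInstance, inferInstance, inferInstance,
      FractionRing (MvPolynomial (Fin 2) (AlgebraicClosure (ZMod 2))), inferInstance,
      inferInstance, IsScalarTower.toAlgHom _ _ _, IsFractionRing.injective _ _⟩
  classical
  -- `S' = k + X₀·k[X₀,X₁]`, `B = ι(S')`, `s = x := ι X₀`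
  obtain ⟨S', hS'⟩ := rtdLocalNeg_exists_supportSubalgebra (k := k) (σ := Fin 2)
    (fun d => d 0 = 0 → d 1 = 0) (fun _ => rfl) (fun a b ha hb h => by
      simp only [Finsupp.coe_add, Pi.add_apply, Nat.add_eq_zero_iff] at h ⊢
      exact ⟨ha h.1, hb h.2⟩)
  have hmonmem : ∀ n : ℕ, (X 0 * X 1 ^ n : MvPolynomial (Fin 2) k) ∈ S' := by
    intro n
    refine (hS' _).mpr fun d hd h0 => ?_
    rw [X_pow_eq_monomial, X, monomial_mul, one_mul, support_monomial, if_neg one_ne_zero,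
      Finset.mem_singleton] at hd
    subst hd
    simp at h0
  have hX0 : (X 0 : MvPolynomial (Fin 2) k) ∈ S' := by simpa using hmonmem 0
  have hx0 : ι (X 0) ≠ 0 := (map_ne_zero_iff ι hι).mpr (X_ne_zero 0)
  have H' := H 2 Nat.prime_two k K (S'.map ι) (ι (X 0)) (Subalgebra.mem_map.mpr ⟨X 0, hX0, rfl⟩)
    hx0
  clear H
  dsimp only at H'
  -- `B' = k[B ∪ {x⁻¹}] = k[x, x⁻¹, y]`
  have hxB' : ι (X 0) ∈ Algebra.adjoin k (((S'.map ι : Subalgebra k K) : Set K) ∪ {(ι (X 0))⁻¹}) :=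
    Algebra.subset_adjoin (Or.inl (Subalgebra.mem_map.mpr ⟨X 0, hX0, rfl⟩))
  have hxiB' : (ι (X 0))⁻¹ ∈
      Algebra.adjoin k (((S'.map ι : Subalgebra k K) : Set K) ∪ {(ι (X 0))⁻¹}) :=
    Algebra.subset_adjoin (Or.inr rfl)
  have hyB' : ι (X 1) ∈ Algebra.adjoin k (((S'.map ι : Subalgebra k K) : Set K) ∪ {(ι (X 0))⁻¹}) := by
    have h : ι (X 1) = (ι (X 0))⁻¹ * ι (X 0 * X 1 ^ 1) := by
      rw [pow_one, map_mul, ← mul_assoc, inv_mul_cancel₀ hx0, one_mul]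
    rw [h]
    exact mul_mem hxiB'
      (Algebra.subset_adjoin (Or.inl (Subalgebra.mem_map.mpr ⟨_, hmonmem 1, rfl⟩)))
  have hB'eq : Algebra.adjoin k (Set.range ![ι (X 0), (ι (X 0))⁻¹, ι (X 1)]) =
      Algebra.adjoin k (((S'.map ι : Subalgebra k K) : Set K) ∪ {(ι (X 0))⁻¹}) := by
    apply le_antisymm
    · refine Algebra.adjoin_le ?_
      rintro _ ⟨i, rfl⟩
      fin_cases i
      exacts [hxB', hxiB', hyB']
    · refine Algebra.adjoin_le ?_
      rintro z (hz | hz)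
      · obtain ⟨P, -, rfl⟩ := Subalgebra.mem_map.mp hz
        have hP : ι P ∈ (Algebra.adjoin k (Set.range (X : Fin 2 → MvPolynomial (Fin 2) k))).map ι := by
          rw [MvPolynomial.adjoin_range_X]
          exact Subalgebra.mem_map.mpr ⟨P, Algebra.mem_top, rfl⟩
        rw [AlgHom.map_adjoin] at hP
        refine (Algebra.adjoin_mono ?_) hP
        rintro _ ⟨_, ⟨i, rfl⟩, rfl⟩
        fin_cases i
        exacts [⟨0, rfl⟩, ⟨2, rfl⟩]
      · rw [Set.mem_singleton_iff] at hz
        subst hz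
        exact Algebra.subset_adjoin ⟨1, rfl⟩
  -- a maximal ideal `m'` of `B'` and the Nullstellensatz shift of the generators into it
  obtain ⟨m', hm'⟩ := Ideal.exists_maximal
    ↥(Algebra.adjoin k (((S'.map ι : Subalgebra k K) : Set K) ∪ {(ι (X 0))⁻¹}))
  let gens : Fin 3 → ↥(Algebra.adjoin k (((S'.map ι : Subalgebra k K) : Set K) ∪ {(ι (X 0))⁻¹})) :=
    ![⟨ι (X 0), hxB'⟩, ⟨(ι (X 0))⁻¹, hxiB'⟩, ⟨ι (X 1), hyB'⟩]
  have hgensval : (fun i => (gens i : K)) = ![ι (X 0), (ι (X 0))⁻¹, ι (X 1)] := by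
    funext i
    fin_cases i <;> rfl
  let Φ := MvPolynomial.aeval (R := k) gens
  have hΦ : Function.Surjective Φ := by
    rw [← AlgHom.range_eq_top, ← Algebra.adjoin_range_eq_range_aeval]
    apply Subalgebra.map_injective (f := Subalgebra.val _) Subtype.val_injective
    rw [AlgHom.map_adjoin, Algebra.map_top, Subalgebra.range_val, ← Set.range_comp]
    show Algebra.adjoin k (Set.range fun i => (gens i : K)) = _
    rw [hgensval]
    exact hB'eq
  haveI := hm'
  obtain ⟨c, hc⟩ := MvPolynomial.isMaximal_iff_eq_vanishingIdeal_singleton.mp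
    (Ideal.comap_isMaximal_of_surjective Φ hΦ (K := m'))
  let g : Fin 3 → ↥(Algebra.adjoin k (((S'.map ι : Subalgebra k K) : Set K) ∪ {(ι (X 0))⁻¹})) :=
    fun i => gens i - algebraMap k _ (c i)
  have hΦX : ∀ i, Φ (X i) = gens i := fun i => MvPolynomial.aeval_X gens i
  have hg : ∀ i, g i ∈ m' := by
    intro i
    have hi : (X i - C (c i) : MvPolynomial (Fin 3) k) ∈ Ideal.comap Φ m' := by
      rw [hc, MvPolynomial.mem_vanishingIdeal_singleton_iff]
      simp
    rw [Ideal.mem_comap, map_sub, hΦX, MvPolynomial.aeval_C] at hi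
    exact hi
  have hgen : Algebra.adjoin k (Set.range fun i => (g i : K)) =
      Algebra.adjoin k (((S'.map ι : Subalgebra k K) : Set K) ∪ {(ι (X 0))⁻¹}) := by
    apply le_antisymm
    · refine Algebra.adjoin_le ?_
      rintro _ ⟨i, rfl⟩
      exact (g i).2
    · refine le_of_eq_of_le hB'eq.symm (Algebra.adjoin_le ?_)
      rintro _ ⟨i, rfl⟩
      have h : (![ι (X 0), (ι (X 0))⁻¹, ι (X 1)] i : K) = (g i : K) + algebraMap k K (c i) := by
        rw [← congr_fun hgensval i]
        change (gens i : K) = ((gens i - algebraMap k _ (c i) : ↥(Algebra.adjoin k _)) : K) + _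
        rw [Subalgebra.coe_sub, Subalgebra.coe_algebraMap, sub_add_cancel]
      rw [h]
      exact add_mem (Algebra.subset_adjoin ⟨i, rfl⟩) (algebraMap_mem _ _)
  -- LHS `Rtd B' m' 0` holds ⇒ RHS `Rtd B (m' ∩ B) 0` holds
  obtain ⟨n, g₂, -, hgen₂, -⟩ := (H' m' hm' 0).mp (by
    refine ⟨3, g, hg, hgen, ⊥, Nat.zero_le _, fun a i => a.1 (g i), ?_, fun a i => a.2 _ (hg i), ?_⟩
    · intro a b hab
      by_cases hex : ∃ j, a.1 (g j) ≠ b.1 (g j)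
      · obtain ⟨j, hj⟩ := hex
        refine ⟨j, fun i => ?_⟩
        rw [sub_self, HahnSeries.orderTop_zero, WithTop.lt_top_iff_ne_top, Ne,
          HahnSeries.orderTop_eq_top, sub_eq_zero]
        exact hj
      · push Not at hex
        exfalso
        apply hab
        apply Subtype.ext
        have hgens : ∀ j, a.1 (gens j) = b.1 (gens j) := fun j => by
          have h := hex j
          simp only [g, map_sub, AlgHom.commutes, sub_left_inj] at h
          exact h
        have hcomp : a.1.comp Φ = b.1.comp Φ :=
          MvPolynomial.algHom_ext fun i => by
            change a.1 (Φ (X i)) = b.1 (Φ (X i))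
            rw [hΦX]
            exact hgens i
        refine AlgHom.ext fun z => ?_
        obtain ⟨P, rfl⟩ := hΦ z
        exact DFunLike.congr_fun hcomp P
    · intro a w _ hw
      refine ⟨a, ?_⟩
      have hle : Submodule.span (HahnSeries ℚ k) ((fun u : Fin 3 → k => fun i => HahnSeries.C (u i)) ''
          ((⊥ : Submodule k (Fin 3 → k)) : Set (Fin 3 → k))) ≤ ⊥ := by
        refine Submodule.span_le.mpr ?_
        rintro _ ⟨u, hu, rfl⟩
        have hu0 : u = 0 := hu
        subst hu0
        change (fun i => HahnSeries.C ((0 : Fin 3 → k) i)) ∈ (⊥ : Submodule (HahnSeries ℚ k) _)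
        rw [Submodule.mem_bot]
        funext i
        simp
      have hw0 : w = 0 := (Submodule.mem_bot _).mp (hle hw)
      rw [hw0, add_zero])
  -- … but `B` is not finitely generated
  refine rtdLocalNeg_not_fg_of_support S' hS' (Subalgebra.fg_of_fg_map S' ι hι ?_)
  exact ⟨(Set.range fun i => (g₂ i : K)).toFinset, by rw [Set.coe_toFinset]; exact hgen₂⟩

end Summit.ResolutionOfSingularities.ResolutionOfSingularities.Theorems
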